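import Summits.BirchSwinnertonDyer.BirchSwinnertonDyer.Theorems.GenusKolyvaginAtTwoMinimalTwinBSDTwoDoorOpenDepthZeroOfBSD
import Summits.BirchSwinnertonDyer.BirchSwinnertonDyer.Theorems.GenusKolyvaginAtTwoMinimalTwinBSDTwoOddCutDepthZeroFrame
import HarnessLib

/-!
# Route `GenusKolyvaginAtTwo`, crux U₂ `MinimalTwinBSDTwo` (stmt-BirchSwinnertonDyer-22985), LINE 23 «twin_swap» — ON THE DOOR-OPEN SUB-CELL OF THE
# ODD HABITAT CUT, U₂ IS EQUIVALENT TO THE CLASSICAL 2-PRIMITIVITY BIT: `BSD₂(W) ↔ y_K ∉ 2W(K[1])` at a door-open budget frame (mod WALL-for-the-twin +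
# PRINT + Q2)

Seat `bsd-line-gk2-p2` g32 (PROVER seat 2/3, cell `bsd-f1-sign2`, LINE 23 holder), `--supports stmt-BirchSwinnertonDyer-22985 --as helper`.
THEOREMS ONLY (no definition, no named fact, no `sorry`).  BSD is NOT proved by any of this; U₂ is NOT proved; nothing is closed.

WHAT.  The two directions landed this session, packaged as one `↔` for the census: at a DOOR-OPEN budget frame (`#Sel₂(Wd) = 1`) of a curve `W` on the
odd habitat cut, with an odd-`c` datum and the twin's `BSD₂` granted (WALL row 1), **`BSD₂(W) ↔ P(1) ∉ 2W(K[1])`**: `←` is p812083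
(`bsdp_onOddCut_of_depthZeroFrame_of_facts`, mod Q2 + PRINT), `→` is p816017 (`depth_eq_zero_of_doorOpen_of_bsdp_pair`, mod PRINT).  So on the door-open
sub-cell U₂'s content is EXACTLY the Gross–Zagier–Kolyvagin `2`-primitivity bit — nothing Kolyvagin-deep, nothing less.
* §1 `bsdp_iff_not_two_dvd_derivedPoint_of_doorOpen_of_facts`.

References: [GrossZagier1986] V.§2 (2.2); [Kolyvagin1989Izv] Thm. A; [MazurRubin2010] Cor. 3.4 (i).
-/

set_option autoImplicit false
set_option linter.dupNamespace false -- `Summit.<P>.<Sub>` repeats `BirchSwinnertonDyer` (D-0017)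

noncomputable section

open scoped Classical

namespace Summit.BirchSwinnertonDyer.BirchSwinnertonDyer.Theorems.GenusExact.TwinSwap.TwinAnnihilation

open Literature.NumberTheory.EllipticCurves Literature.NumberTheory.GaloisRepresentations WeierstrassCurve NumberField
  IsDedekindDomain Field AddSubgroup Literature.NumberTheory.EllipticCurves.ModularForms
open Summit.BirchSwinnertonDyer.Rank1Residual
open Summit.BirchSwinnertonDyer.BirchSwinnertonDyer.Theses.GenusKolyvaginAtTwo (KolyvaginRelationAtTwo)
open Summit.BirchSwinnertonDyer.BirchSwinnertonDyer.Theorems.KolyvaginAtTwo (exists_exactTwoDepth)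

/-- **On the door-open sub-cell, `BSD₂(W) ↔ y_K ∉ 2W(K[1])`.**  `W/ℚ` on the odd habitat cut (globally minimal, non-CM, `r_an = 1`, `#Sel₂ = 2`, `C(W)`
odd, an odd multiplicative prime, `ρ_{W,2^n}` onto); `K` odd `d_K ≠ −3` Heegner; `Dt` with `Dt.c` odd; `P(1)` non-torsion; a globally minimal twin model
`Wd = Cd • W^{(d_K)}` inside the genus budget with `#Sel₂(Wd) = 1` (door OPEN) and `BSD₂(Wd)` (WALL row 1 pays it: the twin is non-CM of analytic rank
`0`).  Then `BSD₂(W) ↔ ¬ ∃ Q, 2 • Q = P(1)`: `←` by p812083 (mod Q2 + PRINT), `→` by p816017 (mod PRINT: the exact depth `M₀` of `P(1)` exists and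
`BSD₂` of the pair forces `M₀ = 0`).  CONDITIONAL; nothing about BSD is proved. [cite: GrossZagier1986, V.§2 (2.2)] [cite: Kolyvagin1989Izv, Thm. A]
[cite: MazurRubin2010, Cor. 3.4 (i)] -/
theorem bsdp_iff_not_two_dvd_derivedPoint_of_doorOpen_of_facts (hQ2 : KolyvaginRelationAtTwo)
    (hGZ : ∀ (N : ℕ) [NeZero N] (W : WeierstrassCurve ℚ) (K : Type) [Field K] [NumberField K], gross_zagier N W K)
    (hGZK : rank_eq_analyticRank_of_analyticRank_le_one) (hmod : hasEntireLFunction_rat)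
    (hMilneC : Milne1972.bsdQuotient_baseChange_quadratic_anyModel)
    (W : WeierstrassCurve ℚ) [W.IsElliptic] [W.IsGloballyMinimal] [NeZero (W.conductorNorm ℤ)] (hcm : ¬ W.HasCM)
    (hr : W.analyticRank = 1) (hSel : Nat.card (W.selmerGroup 2) = 2)
    (hT : Odd W.tamagawaProduct) (v : HeightOneSpectrum (𝓞 ℚ)) (h2v : ((2 : ℕ) : 𝓞 ℚ) ∉ v.asIdeal)
    (hNv : ((W.conductorNorm ℤ : ℕ) : 𝓞 ℚ) ∈ v.asIdeal) (hmult : W.HasMultiplicativeReductionAt v)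
    (hρ : ∀ n : ℕ, 0 < n → W.HasSurjectiveModNGaloisRep ((2 : ℤ) ^ n))
    (K : Type) [Field K] [NumberField K] (hK : IsImaginaryQuadratic K) (hodd : Odd (NumberField.discr K))
    (h3 : NumberField.discr K ≠ -3) (hH : SatisfiesHeegnerHypothesis (W.conductorNorm ℤ) K)
    (Dt : ModularParametrizationData W (W.conductorNorm ℤ)) (hc : Odd Dt.c) (β : ℤ) (ι : K →+* ℂ) (d₁ : KolyvaginHeegnerData Dt β ι 1)
    (hy : ¬ IsOfFinAddOrder d₁.derivedPoint)
    (Wd : WeierstrassCurve ℚ) [Wd.IsElliptic] [Wd.IsGloballyMinimal] (Cd : VariableChange ℚ)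
    (hWd : Cd • W.quadraticTwist (NumberField.discr K : ℚ) = Wd) (hSel1 : Nat.card (Wd.selmerGroup 2) = 1)
    (hbudget : (W.Δ < 0 ∧ padicValNat 2 Wd.tamagawaProduct ≤ 1) ∨ padicValNat 2 Wd.tamagawaProduct = 0) (hBSDd : BSDp Wd 2) :
    BSDp W 2 ↔ ¬ ∃ Q : (W.baseChange (ringClassField K ι 1)).toAffine.Point, (2 : ℤ) • Q = d₁.derivedPoint := by
  constructor
  · intro hBW
    -- the exact depth of `P(1)` exists; BSD₂ of the pair forces it to be `0`
    haveI := (finiteDimensional_and_isGalois_ringClassField hK ι one_ne_zero).1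
    haveI : NumberField (ringClassField K ι 1) := NumberField.of_module_finite K _
    haveI : (W.baseChange (ringClassField K ι 1)).IsElliptic := by rw [baseChange]; infer_instance
    haveI : Module.Finite ℤ (W.baseChange (ringClassField K ι 1)).toAffine.Point := by
      convert (W.baseChange (ringClassField K ι 1)).module_finite_point_holds
    obtain ⟨M₀, hdiv, hndiv⟩ := exists_exactTwoDepth
      (A := (W.baseChange (ringClassField K ι 1)).toAffine.Point) (y := d₁.derivedPoint) (by convert hy)
    have hs2 : W.HasSurjectiveModNGaloisRep 2 := by simpa using hρ 1 one_pos
    have h0 : M₀ = 0 := depth_eq_zero_of_doorOpen_of_bsdp_pair hGZ hGZK hmod hMilneC W hr hSel hT hs2 K hK hodd h3 hH Dt hc β ι d₁ hy M₀ hdiv hndiv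
      Wd Cd hWd hSel1 hbudget hBW hBSDd
    rw [h0] at hndiv
    simpa using hndiv
  · intro hndiv
    exact bsdp_onOddCut_of_depthZeroFrame_of_facts hQ2 hGZ hGZK hmod hMilneC W hcm hr hSel hT v h2v hNv hmult hρ K hK hodd h3 hH Dt hc β ι d₁ hy
      hndiv Wd ⟨Cd, hWd⟩ hbudget hBSDd

end Summit.BirchSwinnertonDyer.BirchSwinnertonDyer.Theorems.GenusExact.TwinSwap.TwinAnnihilation

end
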